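import Summits.RiemannHypothesis.RiemannHypothesis.Theorems.WeilColumnTruncatedWitness
import Summits.RiemannHypothesis.RiemannHypothesis.Theorems.WeilColumnTruncatedTailCut
import Summits.RiemannHypothesis.RiemannHypothesis.Theorems.WeilColumnTruncatedTailNormA
import Summits.RiemannHypothesis.RiemannHypothesis.Theorems.WeilColumnThetaInterfaceBounds
import Literature.Analysis.Calculus.LogCutoff
import HarnessLib

/-!
# The R-UNIFORM `H¹` bound of the truncated odd tail: `∫‖(T_R⁻)′‖² → ∫‖(T⁻)′‖² ≤ P.B` as `R → ∞` (RH-FREE; PR Step 6 input)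

Cell `rh-explicit`, WEIL column, seat handoff-prove-2 gen12 (weil-1 «GO B-UNIFORM» 2026-08-26T07:44Z).  For an admissible row and the
derivative `Θ′` with its D2 majorant (hypotheses `hΘ'`, `hM₁`; = cc-s2-3's `hasDerivAt_deriv_Θ` / `D2_on_Ioc`):

* `hasDerivAt_TROdd` — the explicit derivative of `T_R⁻ = P.TROdd R` (T_R is a `ThetaTail` tail with the cut `truncCut ψ_R χ`, `TR_eq_tail`);
* `norm_sq_deriv_TROdd_le` — domination `‖(T_R⁻)′(x)‖² ≤ G(x)`, `G` integrable and INDEPENDENT of `R` (crude `L + Lψ` envelope);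
* `deriv_TROdd_eq_deriv_TOdd` — for `R > |x|`, `(T_R⁻)′(x) = (T⁻)′(x)` (the smooth step is `1` near `±x`);
* **`tendsto_integral_norm_sq_deriv_TROdd`** : `Tendsto (fun R ↦ ∫‖deriv (P.TROdd R) x‖²) atTop (𝓝 (∫‖deriv P.TOdd x‖²))`
  (dominated convergence), and **`eventually_integral_norm_sq_deriv_TROdd_le`** : `∀ ε > 0, ∀ᶠ R, ∫‖deriv (P.TROdd R) x‖² ≤ P.B + ε`
  (with `WeilColumnThetaInterfaceBounds.integral_norm_sq_deriv_TOdd_le`).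
This is the `B' → P.B` input of `re_weilQuadratic_moll_oddTail_le'` / weil-1's `WeilColumnThetaPRStep6Limit`.  Nothing here bears on RH.
-/

noncomputable section

set_option linter.dupNamespace false

open Complex Set MeasureTheory Filter Function
open scoped Real Topology

namespace Summit.RiemannHypothesis.RiemannHypothesis.Theorems.WeilColumn.ThetaMellin

open Literature.NumberTheory.LFunctions

/-- The smooth step is differentiable: `ψ_R′(x) = smoothTransition′(x + R + 1)` (local copy; weil-1's `PRStep3ZeroDecay` has the public one). -/
private theorem hasDerivAt_smoothStep_aux (R x : ℝ) :
    HasDerivAt (smoothStep R) (deriv Real.smoothTransition (x + R + 1)) x := by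
  have hd : DifferentiableAt ℝ Real.smoothTransition (x + R + 1) :=
    ((Real.smoothTransition.contDiff (n := 1)).differentiable (by simp)) _
  have h := hd.hasDerivAt.comp x (((hasDerivAt_id x).add_const R).add_const 1)
  rw [mul_one] at h
  exact h.congr_of_eventuallyEq (Eventually.of_forall fun y ↦ rfl)

/-- A uniform bound for `|smoothTransition′|` (from `Literature.Analysis.Calculus.LogCutoff`). -/
private theorem exists_smoothStep_deriv_bound_aux : ∃ C : ℝ, 0 ≤ C ∧ ∀ y : ℝ, |deriv Real.smoothTransition y| ≤ C := by
  obtain ⟨C, hC0, hC, -⟩ := Literature.Analysis.Calculus.exists_abs_deriv_and_deriv_deriv_smoothTransition_le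
  exact ⟨C, hC0, hC⟩

namespace ThetaParams

variable (P : ThetaParams)

/-- For `R > |x|` the truncated odd tail agrees with `T⁻` near `x`. -/
theorem TROdd_eventuallyEq_TOdd {R x : ℝ} (hR : |x| < R) : (fun y ↦ P.TROdd R y) =ᶠ[𝓝 x] fun y ↦ P.TOdd y := by
  have hx : x ∈ Ioo (-R) R := by rw [mem_Ioo]; constructor <;> linarith [abs_lt.1 hR |>.1, abs_lt.1 hR |>.2]
  filter_upwards [Ioo_mem_nhds hx.1 hx.2] with y hy
  have h1 : smoothStep R y = 1 := smoothStep_eq_one (by linarith [hy.1])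
  have h2 : smoothStep R (-y) = 1 := smoothStep_eq_one (by linarith [hy.2])
  simp only [TROdd, TR, GR, TOdd, T, h1, h2]
  push_cast
  ring

/-- For `R > |x|`: `(T_R⁻)′(x) = (T⁻)′(x)`. -/
theorem deriv_TROdd_eq_deriv_TOdd {R x : ℝ} (hR : |x| < R) : deriv (P.TROdd R) x = deriv P.TOdd x :=
  (P.TROdd_eventuallyEq_TOdd hR).deriv_eq

variable {Θ' : ℝ → ℂ}

/-- The explicit derivative of `T_R⁻` (a `ThetaTail` odd tail with cut `χ̃_R`). -/
theorem hasDerivAt_TROdd {qn : ℕ} (hP : P.Admissible qn) (hΘ' : ∀ u : ℝ, 0 < u → HasDerivAt P.Θ (Θ' u) u) (R x : ℝ) :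
    HasDerivAt (P.TROdd R)
      (((Real.exp (x / 2) : ℂ) * ((1 / 2 : ℂ) * P.Θ (Real.exp x) + (Real.exp x : ℂ) * Θ' (Real.exp x)) *
          (((1 - truncCut (smoothStep R) P.cut x : ℝ)) : ℂ) -
        (Real.exp (x / 2) : ℂ) * P.Θ (Real.exp x) *
          ((-(deriv Real.smoothTransition (x + R + 1) * (1 - P.cut x)) + smoothStep R x *
            (bsplineDensity (P.η / (2 * P.m)) (P.m - 1) (x + P.a - P.η / 2)).re : ℝ) : ℂ)) +
      ((Real.exp (-x / 2) : ℂ) * ((1 / 2 : ℂ) * P.Θ (Real.exp (-x)) + (Real.exp (-x) : ℂ) * Θ' (Real.exp (-x))) *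
          (((1 - truncCut (smoothStep R) P.cut (-x) : ℝ)) : ℂ) -
        (Real.exp (-x / 2) : ℂ) * P.Θ (Real.exp (-x)) *
          ((-(deriv Real.smoothTransition (-x + R + 1) * (1 - P.cut (-x))) + smoothStep R (-x) *
            (bsplineDensity (P.η / (2 * P.m)) (P.m - 1) (-x + P.a - P.η / 2)).re : ℝ) : ℂ))) x := by
  have hm2 : 2 ≤ P.m := le_trans (by norm_num) hP.three_le
  have hχ' : ∀ y, HasDerivAt (truncCut (smoothStep R) P.cut)
      (-(deriv Real.smoothTransition (y + R + 1) * (1 - P.cut y)) + smoothStep R y *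
        (bsplineDensity (P.η / (2 * P.m)) (P.m - 1) (y + P.a - P.η / 2)).re) y :=
    fun y ↦ hasDerivAt_truncCut (fun z ↦ hasDerivAt_smoothStep_aux R z) (fun z ↦ P.hasDerivAt_cut hP.eta_pos hm2 z) y
  have hfun : P.TROdd R = fun y ↦ expProfile P.Θ y * (((1 - truncCut (smoothStep R) P.cut y : ℝ)) : ℂ) -
      expProfile P.Θ (-y) * (((1 - truncCut (smoothStep R) P.cut (-y) : ℝ)) : ℂ) := by
    funext y; rw [TROdd, TR_eq_tail, TR_eq_tail]
  rw [hfun]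
  exact ThetaTail.hasDerivAt_oddTail (Θ := P.Θ) (χ := truncCut (smoothStep R) P.cut)
    (χ' := fun y ↦ -(deriv Real.smoothTransition (y + R + 1) * (1 - P.cut y)) + smoothStep R y *
      (bsplineDensity (P.η / (2 * P.m)) (P.m - 1) (y + P.a - P.η / 2)).re) hΘ' hχ' x

/-- **Domination, uniform in `R`**: with `Cψ ≥ sup|ψ′|`, `L̃ = m/η + Cψ`,
`‖(T_R⁻)′(x)‖² ≤ G(x) := g(x) + g(−x)`, `g = 1_{(−∞,x₁]}·(4((½+L̃)M)²·eˣ r^{2m} + 4M₁²·eˣ r^{2m−2})`, `r = eˣ/u₁`. -/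
theorem norm_sq_deriv_TROdd_le {qn : ℕ} (hP : P.Admissible qn) (hΘ' : ∀ u : ℝ, 0 < u → HasDerivAt P.Θ (Θ' u) u)
    (hM₁ : ∀ u ∈ Ioc (0 : ℝ) P.u₁, ‖(u : ℂ) * Θ' u‖ ≤ P.M₁ * (u / P.u₁) ^ (P.m - 1))
    {Cψ : ℝ} (hCψ : ∀ y : ℝ, |deriv Real.smoothTransition y| ≤ Cψ) (R x : ℝ) :
    ‖deriv (P.TROdd R) x‖ ^ 2 ≤
      (Iic P.x₁).indicator (fun y ↦ 4 * ((1 / 2 + (P.m / P.η + Cψ)) * P.M) ^ 2 * (Real.exp y * (Real.exp y / P.u₁) ^ (2 * P.m)) +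
          4 * P.M₁ ^ 2 * (Real.exp y * (Real.exp y / P.u₁) ^ (2 * (P.m - 1)))) x +
        (Iic P.x₁).indicator (fun y ↦ 4 * ((1 / 2 + (P.m / P.η + Cψ)) * P.M) ^ 2 * (Real.exp y * (Real.exp y / P.u₁) ^ (2 * P.m)) +
          4 * P.M₁ ^ 2 * (Real.exp y * (Real.exp y / P.u₁) ^ (2 * (P.m - 1)))) (-x) := by
  have hm1 : 1 ≤ P.m := le_trans (by norm_num) hP.three_le
  have hm2 : 2 ≤ P.m := le_trans (by norm_num) hP.three_le
  set L : ℝ := P.m / P.η + Cψ with hL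
  set χ := truncCut (smoothStep R) P.cut with hχdef
  set χ' : ℝ → ℝ := fun y ↦ -(deriv Real.smoothTransition (y + R + 1) * (1 - P.cut y)) + smoothStep R y *
      (bsplineDensity (P.η / (2 * P.m)) (P.m - 1) (y + P.a - P.η / 2)).re with hχ'def
  have hχ01 : ∀ y, χ y ∈ Icc (0 : ℝ) 1 := truncCut_mem_Icc (smoothStep_mem_Icc R) (P.cut_mem_Icc hP.eta_pos hm1)
  have hχ1 : ∀ y, P.x₁ ≤ y → χ y = 1 := fun y hy ↦ truncCut_eq_one (fun z hz ↦ P.cut_eq_one hP.eta_pos hm1 hz) hy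
  have hχ' : ∀ y, HasDerivAt χ (χ' y) y :=
    fun y ↦ hasDerivAt_truncCut (fun z ↦ hasDerivAt_smoothStep_aux R z) (fun z ↦ P.hasDerivAt_cut hP.eta_pos hm2 z) y
  have hLb : ∀ y, |χ' y| ≤ L := by
    intro y
    have h := abs_deriv_truncCut_le (smoothStep_mem_Icc R) (P.cut_mem_Icc hP.eta_pos hm1)
      (fun z ↦ hCψ (z + R + 1)) (fun z ↦ P.abs_cut_deriv_le hP.eta_pos hm2 z) y
    rw [hL, add_comm]; exact h
  have hu₁ : P.u₁ = Real.exp P.x₁ := rfl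
  have hM := fun u (hu : u ∈ Ioc (0 : ℝ) P.u₁) ↦ P.norm_Θ_le' hP hu.1
  -- the one-sided tail derivative and its bound `b`
  set tailD : ℝ → ℂ := fun y ↦ (Real.exp (y / 2) : ℂ) * ((1 / 2 : ℂ) * P.Θ (Real.exp y) + (Real.exp y : ℂ) * Θ' (Real.exp y)) *
      (((1 - χ y : ℝ)) : ℂ) - (Real.exp (y / 2) : ℂ) * P.Θ (Real.exp y) * (χ' y : ℂ) with htailD
  have hderiv : deriv (P.TROdd R) x = tailD x + tailD (-x) := by
    have h := (P.hasDerivAt_TROdd hP hΘ' R x).deriv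
    rw [h]
  set A₁ : ℝ → ℝ := fun y ↦ (1 / 2 + L) * P.M * Real.exp (y / 2) * (Real.exp y / P.u₁) ^ P.m with hA₁
  set A₂ : ℝ → ℝ := fun y ↦ P.M₁ * Real.exp (y / 2) * (Real.exp y / P.u₁) ^ (P.m - 1) with hA₂
  have hb : ∀ y, ‖tailD y‖ ≤ (Iic P.x₁).indicator (fun y ↦ A₁ y + A₂ y) y := by
    intro y
    by_cases hy : y ≤ P.x₁
    · rw [indicator_of_mem (show y ∈ Iic P.x₁ from hy)]
      exact ThetaTail.norm_deriv_tail_le hu₁ hM hM₁ hχ01 hLb hy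
    · rw [indicator_of_notMem (show y ∉ Iic P.x₁ from hy)]
      rw [show tailD y = 0 from ThetaTail.deriv_tail_eq_zero (Θ := P.Θ) (Θ' := Θ') hχ1 hχ' (not_le.1 hy)]
      simp
  -- squares of the envelope pieces
  have hsq : ∀ y : ℝ, Real.exp (y / 2) ^ 2 = Real.exp y := by
    intro y; rw [sq, ← Real.exp_add]; ring_nf
  have hpow : ∀ (y : ℝ) (n : ℕ), ((Real.exp y / P.u₁) ^ n) ^ 2 = (Real.exp y / P.u₁) ^ (2 * n) := by
    intro y n; rw [← pow_mul, mul_comm]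
  have hind : ∀ y, ((Iic P.x₁).indicator (fun y ↦ A₁ y + A₂ y) y) ^ 2 ≤
      (1 / 2 : ℝ) * (Iic P.x₁).indicator (fun y ↦ 4 * ((1 / 2 + L) * P.M) ^ 2 * (Real.exp y * (Real.exp y / P.u₁) ^ (2 * P.m)) +
        4 * P.M₁ ^ 2 * (Real.exp y * (Real.exp y / P.u₁) ^ (2 * (P.m - 1)))) y := by
    intro y
    by_cases hy : y ∈ Iic P.x₁
    · rw [indicator_of_mem hy, indicator_of_mem hy]
      have e1 : A₁ y ^ 2 = ((1 / 2 + L) * P.M) ^ 2 * (Real.exp (y / 2) ^ 2 * ((Real.exp y / P.u₁) ^ P.m) ^ 2) := by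
        simp only [hA₁]; ring
      have e2 : A₂ y ^ 2 = P.M₁ ^ 2 * (Real.exp (y / 2) ^ 2 * ((Real.exp y / P.u₁) ^ (P.m - 1)) ^ 2) := by
        simp only [hA₂]; ring
      rw [hsq, hpow] at e1 e2
      nlinarith [sq_nonneg (A₁ y - A₂ y), e1, e2]
    · rw [indicator_of_notMem hy, indicator_of_notMem hy]; norm_num
  -- assemble
  rw [hderiv]
  have h1 := hb x
  have h2 := hb (-x)
  have h0 : 0 ≤ (Iic P.x₁).indicator (fun y ↦ A₁ y + A₂ y) x := (norm_nonneg _).trans h1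
  have h0' : 0 ≤ (Iic P.x₁).indicator (fun y ↦ A₁ y + A₂ y) (-x) := (norm_nonneg _).trans h2
  have hsum : ‖tailD x + tailD (-x)‖ ≤ (Iic P.x₁).indicator (fun y ↦ A₁ y + A₂ y) x +
      (Iic P.x₁).indicator (fun y ↦ A₁ y + A₂ y) (-x) := (norm_add_le _ _).trans (add_le_add h1 h2)
  have hsq2 : ‖tailD x + tailD (-x)‖ ^ 2 ≤ 2 * ((Iic P.x₁).indicator (fun y ↦ A₁ y + A₂ y) x) ^ 2 +
      2 * ((Iic P.x₁).indicator (fun y ↦ A₁ y + A₂ y) (-x)) ^ 2 := by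
    nlinarith [pow_le_pow_left₀ (norm_nonneg _) hsum 2, sq_nonneg ((Iic P.x₁).indicator (fun y ↦ A₁ y + A₂ y) x -
      (Iic P.x₁).indicator (fun y ↦ A₁ y + A₂ y) (-x))]
  have := hind x
  have := hind (-x)
  rw [hL] at *
  linarith

/-- The dominating function is integrable. -/
theorem integrable_dominator (K₁ K₂ : ℝ) :
    Integrable fun x ↦
      (Iic P.x₁).indicator (fun y ↦ K₁ * (Real.exp y * (Real.exp y / P.u₁) ^ (2 * P.m)) +
          K₂ * (Real.exp y * (Real.exp y / P.u₁) ^ (2 * (P.m - 1)))) x +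
        (Iic P.x₁).indicator (fun y ↦ K₁ * (Real.exp y * (Real.exp y / P.u₁) ^ (2 * P.m)) +
          K₂ * (Real.exp y * (Real.exp y / P.u₁) ^ (2 * (P.m - 1)))) (-x) := by
  have hu₁ : P.u₁ = Real.exp P.x₁ := rfl
  have hg : Integrable ((Iic P.x₁).indicator fun y ↦ K₁ * (Real.exp y * (Real.exp y / P.u₁) ^ (2 * P.m)) +
      K₂ * (Real.exp y * (Real.exp y / P.u₁) ^ (2 * (P.m - 1)))) := by
    refine IntegrableOn.integrable_indicator ?_ measurableSet_Iic
    exact ((ThetaTail.integrableOn_exp_mul_pow_Iic hu₁ (2 * P.m)).const_mul _).add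
      ((ThetaTail.integrableOn_exp_mul_pow_Iic hu₁ (2 * (P.m - 1))).const_mul _)
  exact hg.add hg.comp_neg

/-- **`∫‖(T_R⁻)′‖² → ∫‖(T⁻)′‖²` as `R → ∞`** (dominated convergence). [THETA-ASSIGN §6 Step 6 input] -/
theorem tendsto_integral_norm_sq_deriv_TROdd {qn : ℕ} (hP : P.Admissible qn)
    (hΘ' : ∀ u : ℝ, 0 < u → HasDerivAt P.Θ (Θ' u) u)
    (hM₁ : ∀ u ∈ Ioc (0 : ℝ) P.u₁, ‖(u : ℂ) * Θ' u‖ ≤ P.M₁ * (u / P.u₁) ^ (P.m - 1)) :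
    Tendsto (fun R : ℝ ↦ ∫ x, ‖deriv (P.TROdd R) x‖ ^ 2) atTop (𝓝 (∫ x, ‖deriv P.TOdd x‖ ^ 2)) := by
  obtain ⟨Cψ, hC0, hCψ⟩ := exists_smoothStep_deriv_bound_aux
  set K₁ : ℝ := 4 * ((1 / 2 + (P.m / P.η + Cψ)) * P.M) ^ 2 with hK₁
  set K₂ : ℝ := 4 * P.M₁ ^ 2 with hK₂
  refine tendsto_integral_filter_of_dominated_convergence
    (fun x ↦ (Iic P.x₁).indicator (fun y ↦ K₁ * (Real.exp y * (Real.exp y / P.u₁) ^ (2 * P.m)) +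
          K₂ * (Real.exp y * (Real.exp y / P.u₁) ^ (2 * (P.m - 1)))) x +
        (Iic P.x₁).indicator (fun y ↦ K₁ * (Real.exp y * (Real.exp y / P.u₁) ^ (2 * P.m)) +
          K₂ * (Real.exp y * (Real.exp y / P.u₁) ^ (2 * (P.m - 1)))) (-x))
    (Eventually.of_forall fun R ↦ ?_) (Eventually.of_forall fun R ↦ Eventually.of_forall fun x ↦ ?_)
    (P.integrable_dominator K₁ K₂) (Eventually.of_forall fun x ↦ ?_)
  · exact ((measurable_deriv (P.TROdd R)).norm.pow_const 2).aestronglyMeasurable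
  · rw [Real.norm_of_nonneg (sq_nonneg _)]
    exact P.norm_sq_deriv_TROdd_le hP hΘ' hM₁ hCψ R x
  · refine tendsto_const_nhds.congr' ?_
    filter_upwards [eventually_gt_atTop |x|] with R hR
    rw [P.deriv_TROdd_eq_deriv_TOdd hR]

/-- **`∀ ε > 0`, eventually in `R`: `∫‖(T_R⁻)′‖² ≤ P.B + ε`** (the R-uniform `B` of PR Step 6). [THETA-ASSIGN §6] -/
theorem eventually_integral_norm_sq_deriv_TROdd_le {qn : ℕ} (hP : P.Admissible qn)
    (hΘ' : ∀ u : ℝ, 0 < u → HasDerivAt P.Θ (Θ' u) u)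
    (hM₁ : ∀ u ∈ Ioc (0 : ℝ) P.u₁, ‖(u : ℂ) * Θ' u‖ ≤ P.M₁ * (u / P.u₁) ^ (P.m - 1)) {ε : ℝ} (hε : 0 < ε) :
    ∀ᶠ R : ℝ in atTop, ∫ x, ‖deriv (P.TROdd R) x‖ ^ 2 ≤ P.B + ε := by
  have hlim := P.tendsto_integral_norm_sq_deriv_TROdd hP hΘ' hM₁
  have hB := P.integral_norm_sq_deriv_TOdd_le hP hΘ' hM₁
  have hlt : ∫ x, ‖deriv P.TOdd x‖ ^ 2 < P.B + ε := by linarith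
  filter_upwards [(tendsto_order.1 hlim).2 _ hlt] with R hR
  exact hR.le

end ThetaParams

end Summit.RiemannHypothesis.RiemannHypothesis.Theorems.WeilColumn.ThetaMellin

end
-- 2026-08-26T09:06Z: byte-identical re-land to trigger the skipped hub build (accepted 08:1xZ, no olean after 50 min); no content change.
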